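import Mathlib.MeasureTheory.Measure.MeasureSpaceDef
import Mathlib.Algebra.Order.AbsoluteValue.Basic
import Mathlib.Algebra.Module.Equiv.Basic
import Mathlib.Data.Real.Basic
import Mathlib.Data.Nat.Prime.Basic
import HarnessLib

/-!
# R-J attach points A1 (Ind2) / A2 (hull-vs-subset) / A3 (q-normalisation): the JOSHI-SIDE latest sentences —
# «Final Report on the Mochizuki–Scholze–Stix Controversy» (arXiv:2505.10568, May 2025) and «FAQ about the proof of the
# abc-conjecture» (Nov 1, 2025) — located and typed

Record file of the abc-iut cell, block E / D-0079 R-J «JOSHI Y-DISCHARGE CENSUS» (`HOME/plan/E/R-J/Y-CENSUS.tsv`, rows **Y-12** (A1),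
**Y-19** (A3), **Y-20** (A2)); seat lit-abc-joshi (literature-prover, D-0088(4) cross-ladder LIT-TYPING; director-abc row (5)
2026-08-26T13:24:23Z). Companion of `Joshi/AttachPointsMochizukiRpt2024.lean` (the Mochizuki-side sentences of March 2024). **No side
is taken** on [IUTchIII] Cor. 3.12, on Joshi's claims or on Mochizuki's report; typed ≠ proved ≠ endorsed; nothing here asserts abc
proved or refuted. All three sources below are UNREFEREED documents by the author (D-0012; the other party's printed view of the series
is Mochizuki2024JoshiReport (ShtAns)); they change NO statement or numbering of [J-I]–[J-IV]/[J-IIp]/[J-2½] (versions of record: Feb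
2025, `plan/E/lit/VERSIONS.md`), whose typed candidates (JOSHI-DAG v1.6.1) are cited BY NAME, never re-typed (DEFS-FREEZE).

SOURCES (chronological; «latest» = FAQ):
* **FR** = K. Joshi, *Final Report on the Mochizuki–Scholze–Stix Controversy*, arXiv:2505.10568v1 (May 2025), bib `Joshi2025Report`,
  lit key `paper:arxiv-2505.10568`. HELD ONLY as a corpus-TeX render in 3000-character CHUNKS (`HOME/plan/repair/lit/renders/
  Joshi-arxiv-2505.10568-FinalReport-chunks/p0001–p0005.txt`; E-lit VERSIONS.md 11:05Z «quote it by section, not page»): locators below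
  are «§, chunk:line». The render drops some TeX macros (the IUTT and Θ macros print as blanks); restored glyphs are marked ‹Θ›.
* **FAQ** = K. Joshi, *FAQ about the proof of the abc-conjecture* (web document dated November 1, 2025, 22 pp.), bib `Joshi2025FAQ`, lit
  key `paper:url-a28b6de44c80`, PDF-paged render `HOME/plan/repair/lit/renders/Joshi-MochizukiFAQ2025-url-a28b6de44c80/pNNNN.txt`
  (PDF page N, l = line). This is the author's LATEST text; rp-lit PATHS.md (iii): «answers to (Js1)–(Js3)/(EssGl) of Rpt2024-03».
* **JSR24** = K. Joshi, *The status of the Scholze–Stix Report …* (June 28, 2024, 13 pp.), bib `Joshi2024StatusReport`, render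
  `…/Joshi-StatusReport2024-url-e5a01d3076ea/`; superseded by FR §0.1 except for its timeline entry on Mochizuki's report (p.10).

CELL RULE FOR EXPOSITORY TEXT (as in the companion file and `Literature/IUT/LogVolume/Theorem110Remarks.lean`): VERBATIM located
sentences in sectioning doc-comments («[…]» = elision); CHECKABLE elementary content typed and PROVED ([folklore]); readings that the
cell's kernel already names are cited BY NAME; META sentences (who proved what, who read what) carry NO declaration; new `def`s are
READING PREDICATES / toy carriers, never asserted; no `Prop` fact, no instance, no notation.

## What the Joshi-side texts print on the three attach points (located; VERBATIM)

### A1 — (Ind2) content / «distinct arithmetic holomorphic structures» (Y-12; kernel: `ATS3.IndDictionary.JInd2InIsm`, horns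
### `not_jInd2InIsm_of_rescaling` (ii) / `jInd2InIsm_of_ism_univ`, Joshi/TestIndeterminacies.lean; criterion p440522)
* FR §0.2, chunk 1 l.34: «At the very center of the issue is that Mochizuki's quantification of what it means to be an Arithmetic
  Holomorphic Structure is mathematically inadequate to quantitatively assert that one has two or more such structures. This last point is
  needed because in the proof of the abc-conjecture one compares and averages over arithmetic quantities arising from many such structures,
  and so it is important to unambiguously prove the existence of many such structures.» — META + the author's claim that plurality is
  NEEDED (opposed in print by Mochizuki2024JoshiReport (RCΘlg) p.7 l.2–16 «never logically applied»; companion file). No decl.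
* FR §0.2, chunk 2 l.5–7: «this argument of [mochizuki-essential-logic] is not only flawed (because it simply declares the existence of
  distinct arithmetic holomorphic structures), but mathematically superfluous. There is a canonical definition of arithmetic holomorphic
  structures ([joshi-teich], [joshi-untilts]) […]» — META. FR §0.3 Table 1, chunk 3 l.1, row «distinct Arith. Holomorphic Structures |
  Asserted in [mochizuki-iut1] but existence is not clearly established | [Scholze–Stix] declare that these cannot exist | Demonstrates
  the existence and deformation property via arbitrary alg. closed perfectoid fields or equivalently by using arbitrary geom. base-points»
  — META (typed objects: `ArithHolStructure.lean`, `ArithTeichmullerSpace.lean`, E-t7/E-t1 lineages).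
* FR §0.3 Table 2, chunk 3 l.40, row «Section 2.2 (main disproof argument) | This argument of [scholze-stix] fails because the ‹Θ›_gau-Link
  does come with a non-trivial j^2-scaling factor for j = 1, …, (ℓ−1)/2 and also is equipped with a non-trivial Galois action
  [joshi-teich-rosetta]» — the `j²` half is A3 (§2 below: `JSqScaling`); the «non-trivial Galois action» half bears on A1: in the kernel
  Joshi's own Galois move is an ISOMETRY (`AnsatzGaloisIsometry`, p430404, Y-23 — horn (i)), cited, not adjudicated.
* FAQ Q23, p.11 l.13–23: «My assertion of incompleteness is based on the genuine difficulty one encounters in using Mochizuki's toolkit in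
  proving his assertions. The central difficulty is to show that there exist distinct arithmetic holomorphic structures […]. The second
  difficulty is to demonstrate the existence and non-triviality of various symmetries (Galois action, Θ-Links, log-Links/global Frobenius)
  asserted by Mochizuki.» — META.
* FAQ Q30, p.13 l.21–28: «Mochizuki does not construct Arithmetic Teichmüller Spaces (but I do) nor does he provide any way of
  distinguishing between arithmetic holomorphic structures, so Mochizuki reminds us in [Mochizuki, 2021d, Remark 3.11.1(i), Page 581–585]
  that the proofs of [Mochizuki, 2021d, Theorem 3.11 and Corollary 3.12] requires one to work with distinct arithmetic holomorphic structures
  (by assigning arbitrary labels † and ‡ if necessary). The gist of the said remark is that working with distinct arithmetic holomorphic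
  structures is absolutely necessary, as one wants to average over a collection of such structures, to avoid logical contradictions or
  ∈-loops.» — the author's LATEST sentence on the A1 question; META (a reading of [IUTchIII] Rmk 3.11.1 (i)); no decl.
* FAQ Q37, p.17 l.10–18 — the author's LATEST sentence on HOW Tate parameters from distinct structures are compared (his (Ind2)/collation
  reading): «Mochizuki's approach via Galois cohomology rests on the facts that y_1, y_2 give isomorphic Galois cohomologies: q_1 ∈
  H¹(Gal(Q̄_p/Q_p)_{y_1}, Q_p(1)_{y_1}) ≃ H¹(Gal(Q̄_p/Q_p)_{y_2}, Q_p(1)_{y_2}), and the Tate parameters give rise to Galois cohomology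
  classes in these groups. There is no canonical isomorphism between these groups, and in general, q_1 is not carried into q_2 under such
  isomorphisms. Hence, one must consider all Q_p-vector space isomorphisms between these groups arising from isomorphisms of the pairs
  (Gal(Q̄_p/Q_p)_{y_1} ↷ Q_p(1)_{y_1}) ≃ (Gal(Q̄_p/Q_p)_{y_2} ↷ Q_p(1)_{y_2}) and collate images of Tate parameters q_1 by fixing one y_2».
  CHECKABLE algebraic kernel, §1 below: a pair (G ↷ M) over a commutative ring R admits the pair-automorphisms (id_G, c·) for every unit
  c — scalar rescalings ARE «isomorphisms of the pairs» (`scalarPairAut`, PROVED equivariant); with the archimedean size |c| ≠ 1 (e.g. c = p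
  on a ℚ-line container, `abs_natCast_ne_one_of_prime`) this is exactly the hypothesis shape of E-cx's horn (ii) `not_jInd2InIsm_of_rescaling`
  («a σ acting on a container line by y ↦ c·y, |c| ≠ 1, violates JInd2InIsm» — Mochizuki's Ism = isometries, EL-079). LOCATED, not
  adjudicated: whether [IUTchIII] (Ind2) is Ism (isometries) or the pair-induced linear isomorphisms of Q37 is attach point A1 itself.
* FAQ Q29, p.12 l.35–41 (the author's latest reply to Mochizuki2024JoshiReport): «Mochizuki's report on my work makes it clear that he had not
  read my global approach because no mention of [Joshi, 2023a] occurs in his report […]; and secondly, as I have said in the current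
  version (Feb 2025) of [Joshi, 2024b], in the first version (March 2024), I had missed the usage of the global Frobenius at a critical
  juncture. [This omission has been fixed in the current versions of my relevant papers on the arxiv.]»; JSR24 p.10 l.20–30 (June 2024):
  «if there are any counter examples, to [Joshi, 2024a], as Mochizuki claims in his comments, then they will also apply to [Mochizuki,
  2021d]» — META (bears on (EssGl)/(HllVl)); no decl.

### A3 — q-pilot/Θ-pilot normalisation and «valuation scaling» (Y-19; kernel: `Joshi.ThetaValuationScaling` = (9.9.4)'s `(j/ℓ⋆)²` law,
### `ThetaSquareLaw` = the `j²` law (Joshi/TestScalingHarnessBridge.lean), p433340 / p434945; `Thm110Numerics.absLogq` = «(1/2l)·log(q)»)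
* FR Table 2, chunk 3 l.40 (quoted above): the ‹Θ›_gau-Link carries «a non-trivial j^2-scaling factor for j = 1, …, (ℓ−1)/2» — the author's
  2025 summary uses the BARE `j²` of [J-III] Thm 4.2.2.1 (4) p.33 / [IUTchIII], not the renormalised `(j/ℓ⋆)²` of his (9.9.4) p.121 (ref-x
  sheet FAITHFUL-ATS3FundamentalEstimate: «the ℓ⋆² denominator is the author's own renormalisation (Cor 4.2.2.4, §4.5)»). §2 below types the
  two exponent laws (`JSqScaling`, `NormalisedScaling`) and PROVES they are incompatible for ℓ⋆ ≥ 2 and that only the second keeps every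
  exponent ≤ 1 (q pinned at the LAST label, E-LOCATION §L2) — a kernel record of the two horns of A3, both printed by the same author.
  FR Table 2, chunk 3 l.36: «Section 2.1.7, 2.1.8 | Each holomorphoid provides q and ‹Θ›-Pilot object [joshi-teich-rosetta]» — META.
* FAQ Q12, p.8 l.6–13: «Mochizuki asserted, that there is an arithmetic version of this relative Teichmüller type scaling of the Tate
  parameters i.e. the p-adic periods of a semi-stable elliptic curve. But, using Mochizuki's group-theoretic methods and tools, it is
  genuinely difficult to prove that this relative scaling exists in the p-adic case and is non-trivial. From my point of view this relative
  scaling exists simply because the valuations of all the large fields K […] cannot be simultaneously normalized. So the Tate parameters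
  i.e. p-adic periods do occur at distinct valuation scales relative to each other.» — the author's latest sentence on WHY a normalisation
  choice arises at all; META.
* FAQ Q17, p.9 l.28–31: «if |T|_{C((T))} = c for some real number 0 < c < 1, then |T|_{C((T^{1/n}))} = c^n.» — CHECKABLE (an absolute value
  is multiplicative: the n-th power of the uniformiser `T^{1/n}`, of size c, has size cⁿ), §2 `faq17_uniformiser_pow`.
  FAQ Q18, p.9 l.35 – p.10 l.10: «if |p|_{C_p} = 1/p (this is the standard normalization), then |p|_K = 1/p^λ for some λ ∈ ℝ. This is
  precisely the sort of relationship Mochizuki asserts in [Mochizuki, 2021d, Theorem 3.11 and Remark 3.11.1]. The non-trivial aspect here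
  is that the valued field (K, |−|_K) is not isomorphic to (C_p, |−|^ν_{C_p}) for any ν ∈ ℝ as the fields K are not topologically isomorphic.
  So this scaling of valuations given above arises from the fact that arithmetic holomorphic structures are distinct, and this scaling is
  quite non-trivial in general (as [Mochizuki, 2021d, Theorem 3.11] requires). […] replacing (C_p, |−|_{C_p}) by (C_p, |−|^λ_{C_p}) is a
  trivial scaling of valuation and that is not what one wants to do at all.» — the K-side (non-isomorphic untilts) is NOT-IN-MATHLIB; the
  dichotomy «non-trivial scaling λ ≠ 1 of the value of p» vs «trivial re-normalisation |−|^λ of one field» is the A1/A3 junction: on the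
  cell's containers a λ-rescaling is horn (ii) (E-t1 `ActionDilates`, E-cx `not_jInd2InIsm_of_rescaling`); located, no further decl.

### A2 — hull-vs-subset (Y-20; kernel: E-cx `SubsetVolumeBound` / `HullVolumeDominance` / `statement_of_subsetVolumeBound`, X-07′
### `¬HullDefined` p431886)
* FR: NOTHING on hulls, convex closures or subsets (grep «hull» = 0 in all five chunks): NOT-IN-PRINT (FR). FR §0.1, chunk 1 l.25:
  «Proofs of all my mathematical assertions in this context may be found in the revised versions (Feb 2025) of [the ATS papers]» — i.e. the
  author's latest A2 statement is [J-III] v4 Lemma 9.10.7.1 p.125 l.42–53 («Vol_Γ(hull(S′)) ≥ Vol_{Γ_p}(hull(S)) ≥ Vol_{Γ_p}(S) ≥ ∏|s_i|»)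
  with Thm 9.11.1's proof p.127 l.41–55 — typed by E as `SubsetVolumeBound` (the exhibited-subset shape), cited BY NAME.
* FAQ Q34, p.15 l.25–34 (geometric toy) and Q36, p.16 l.29–43 (arithmetic case) — the author's LATEST framing, ENLARGE-THEN-BOUND (the
  set glyphs Σ, Σ_n, Σ̃, S are dropped by the render's text layer and are restored here from context; check against the PDF): «Suppose
  Σ a set of non-isotrivial elliptic curves over C((T)). The problem one has is how to compute an upper bound on a suitably defined volume of
  Σ. By applying the above procedure to each E ∈ Σ and each n ≥ 1, one obtains a subset Σ_n […], and a subset Σ̃ = ∪_n Σ_n […], and obviously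
  Σ_1 = Σ. Now suppose that, by some other method, one has obtained an upper bound for the volume of Σ̃, then one has (indirectly) solved the
  problem of bounding the volume of Σ.» / «Mochizuki's idea (in my formulation) is to carefully chose a subset S ⊂ Y_L of arithmeticoids of L
  […] and enlarge Σ by taking Σ̃ = {q_{E;y} […] : y ∈ S} and estimate the size of Σ̃ instead. Mochizuki's observation is that if the subset
  S is chosen carefully to be stable under various symmetries of Y_L, then estimating the volume of Σ̃ in a suitable adelic space is (delicate
  but) actually doable.» — CHECKABLE logical content, §3 below: `Σ = Σ_1 ⊆ ⋃_n Σ_n = Σ̃` and monotonicity of any measure give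
  `vol(Σ) ≤ vol(Σ̃) ≤ B` (`faq34_enlarge_then_bound`, PROVED). KERNEL LOCATION: this is the CONTAINMENT direction (the q-side set INSIDE the
  enlarged/orbit set; E-cx `IndCoversQ`/HVD shape) — the opposite bookkeeping from (HllVl)'s «stronger pre-hull inequality» (SVB: an
  exhibited SUBSET of the Θ-side bounds the volume from BELOW); which of the two the printed proofs instantiate is Y-20 itself, recorded on
  both sides, adjudicated by neither file.

Deliberately NOT here: FR §0.4 «Final Conclusion» and Table 2's other rows (status claims about [scholze-stix]; quoted in
`Literature/Barriers/ABC/IUTDisputedClaim.lean`); FAQ Q1–Q11, Q14–Q16, Q19–Q22, Q24–Q28, Q31–Q33, Q35, Q38–Q41 (background, geometric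
case, universes/∈-loops, timeline). Standard axioms only; no `sorry`.
-/

noncomputable section

namespace Summit.ABC.IUTFork.Joshi.Reports2025

/-! ## 1. A1 — FAQ Q37 p.17 l.15–17: scalar rescalings are «isomorphisms of the pairs (G ↷ M)» -/

section PairAut

variable {R : Type*} [CommRing R] {G : Type*} [Monoid G] {M : Type*} [AddCommGroup M] [Module R M]
  [DistribMulAction G M] [SMulCommClass G R M]

/-- **FAQ Q37 (p.17 l.15–17), the algebra behind «all Q_p-vector space isomorphisms … arising from isomorphisms of the pairs
(Gal ↷ Q_p(1))»**: for a monoid `G` acting `R`-linearly on an `R`-module `M` (the pair `G ↷ M`; Joshi: `G = Gal(Q̄_p/Q_p)_y`,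
`M = Q_p(1)_y`, `R = Q_p`), every unit `c ∈ Rˣ` gives an `R`-linear automorphism `m ↦ c·m` of `M`. DATA (Mathlib's
`LinearEquiv.smulOfUnit`). [folklore] -/
def scalarPairAut (c : Rˣ) : M ≃ₗ[R] M := LinearEquiv.smulOfUnit c

/-- `scalarPairAut c m = c • m`. [folklore] -/
theorem scalarPairAut_apply (c : Rˣ) (m : M) : scalarPairAut (R := R) c m = c • m := rfl

/-- **… and it is `G`-equivariant**, i.e. `(id_G, c·)` is an automorphism OF THE PAIR `(G ↷ M)`; so the pair-induced isomorphisms of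
Q37 include every scalar rescaling by a unit of `R` — on a `ℚ_p`-line, multiplication by `p` (a unit of `ℚ_p` of size `≠ 1`). The
elementary fact only; that [IUTchIII] (Ind2) ranges over such maps is Joshi's reading (EL-040, FAQ Q37), opposed by Ism = isometries
(EL-079). [folklore] -/
theorem scalarPairAut_equivariant (c : Rˣ) (g : G) (m : M) :
    scalarPairAut (R := R) c (g • m) = g • scalarPairAut (R := R) c m := by
  rw [scalarPairAut_apply, scalarPairAut_apply, Units.smul_def, Units.smul_def]
  exact (smul_comm g (c : R) m).symm

end PairAut

/-- The hypothesis shape of E-cx's horn (ii) `not_jInd2InIsm_of_rescaling` («|c| ≠ 1» for the rational factor by which a σ acts on a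
`ℚ`-line container) is met by `c = p` for every prime `p` (indeed every natural number `≠ 1`). [folklore] -/
theorem abs_natCast_ne_one_of_prime {p : ℕ} (hp : p.Prime) : |(p : ℚ)| ≠ 1 := by
  rw [Nat.abs_cast]
  exact_mod_cast hp.one_lt.ne'

/-! ## 2. A3 — FR Table 2 «j²-scaling factor» vs [J-III] (9.9.4) «(j/ℓ⋆)²»; FAQ Q17 -/

/-- **FR Table 2, chunk 3 l.40**: «the ‹Θ›_gau-Link does come with a non-trivial j^2-scaling factor for j = 1, …, (ℓ−1)/2» — the BARE
`j²` exponent law on the labels `j = i + 1 ∈ {1, …, ℓ⋆}` (the coefficient of `ThetaSquareLaw`, [IUTchIII] `q̲^{j²}`; [J-III] Thm 4.2.2.1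
(4) p.33). READING PREDICATE on an exponent vector, never asserted. [claim: Joshi2025Report, status: disputed] -/
@[claim "Joshi2025Report" "disputed"]
def JSqScaling (lstar : ℕ) (e : Fin lstar → ℝ) : Prop := ∀ i : Fin lstar, e i = (((i : ℕ) : ℝ) + 1) ^ 2

/-- **[J-III] (9.9.4) p.121 l.1–12** (arXiv:2401.13508v4): the RENORMALISED exponent law `(j/ℓ⋆)²` (the coefficient `scalingWeight` of
E-t4's `Joshi.ThetaValuationScaling`). READING PREDICATE, never asserted. [claim: Joshi2024ATS3, status: disputed] -/
@[claim "Joshi2024ATS3" "disputed"]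
def NormalisedScaling (lstar : ℕ) (e : Fin lstar → ℝ) : Prop :=
  ∀ i : Fin lstar, e i = ((((i : ℕ) : ℝ) + 1) / lstar) ^ 2

/-- **The two printed exponent laws are incompatible as soon as `ℓ⋆ ≥ 2`** (at `j = 1`: `1 ≠ 1/ℓ⋆²`). Kernel record of the two horns
of attach point A3 — `j²` (FR 2025, [IUTchIII], the cell's `ThetaSquareLaw`, C-side htq) vs `(j/ℓ⋆)²` ((9.9.4), `ThetaValuationScaling`,
htqJ) — both in the SAME author's print; which one [IUTchIII] Cor. 3.12 intends is Y-19 (lane A), not decided here. [folklore] -/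
theorem not_jSqScaling_and_normalised {lstar : ℕ} (hl : 2 ≤ lstar) (e : Fin lstar → ℝ) :
    ¬ (JSqScaling lstar e ∧ NormalisedScaling lstar e) := by
  rintro ⟨hJ, hN⟩
  have i0 : 0 < lstar := by omega
  have h1 := hJ ⟨0, i0⟩
  have h2 := hN ⟨0, i0⟩
  rw [h1] at h2
  have hl' : (2 : ℝ) ≤ lstar := by exact_mod_cast hl
  have hpos : (0 : ℝ) < lstar := by linarith
  simp only [Nat.cast_zero, zero_add, one_pow, div_pow] at h2
  rw [eq_div_iff (by positivity)] at h2
  nlinarith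

/-- Under the renormalised law every exponent is `≤ 1` — the Θ-coordinates are at least as large as `q` and the q-parameter is pinned
at the LAST label (`e (ℓ⋆) = 1`): E-LOCATION §L2's located sentence, here on the bare exponent vector. [folklore] -/
theorem normalisedScaling_le_one {lstar : ℕ} {e : Fin lstar → ℝ} (h : NormalisedScaling lstar e) (i : Fin lstar) : e i ≤ 1 := by
  rw [h i]
  have hl : (0 : ℝ) < lstar := by exact_mod_cast Fin.pos i
  have hi : (((i : ℕ) : ℝ) + 1) ≤ lstar := by exact_mod_cast i.is_lt
  have h0 : (0 : ℝ) ≤ (((i : ℕ) : ℝ) + 1) / lstar := by positivity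
  have h1 : (((i : ℕ) : ℝ) + 1) / lstar ≤ 1 := (div_le_one hl).mpr hi
  nlinarith

/-- Under the bare `j²` law the exponent at every label `j ≥ 2` EXCEEDS `1` — the Θ-coordinates there are SMALLER than `q` (the shape
E-cx calls `ThetaBelowQ`, under which no volume-shaped reading holds, `not_volumeTransport_of_thetaBelowQ`). [folklore] -/
theorem one_lt_of_jSqScaling {lstar : ℕ} {e : Fin lstar → ℝ} (h : JSqScaling lstar e) (i : Fin lstar) (hi : 1 ≤ (i : ℕ)) :
    1 < e i := by
  rw [h i]
  have : (1 : ℝ) ≤ ((i : ℕ) : ℝ) := by exact_mod_cast hi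
  nlinarith

/-- **FAQ Q17, p.9 l.28–31** («if |T|_{C((T))} = c […], then |T|_{C((T^{1/n}))} = c^n»): for any absolute value on a semiring and an
element `s` of size `c` (Joshi: the uniformiser `T^{1/n}` of `C((T^{1/n}))`, normalised to size `c`), `s^n` (Joshi: `T`) has size `cⁿ`.
Multiplicativity only; the identification of the fields is the author's example. [folklore] -/
theorem faq17_uniformiser_pow {K : Type*} [CommRing K] [Nontrivial K] (v : AbsoluteValue K ℝ) {s : K} {c : ℝ} (hs : v s = c)
    (n : ℕ) : v (s ^ n) = c ^ n := by
  rw [map_pow, hs]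

/-! ## 3. A2 — FAQ Q34/Q36: ENLARGE-THEN-BOUND (`Σ = Σ₁ ⊆ ⋃ₙ Σₙ = Σ̃`, `vol Σ ≤ vol Σ̃ ≤ B`) -/

open MeasureTheory

/-- **FAQ Q34, p.15 l.25–34 / Q36, p.16 l.29–43**: if `Σ = Σ_1`, `Σ̃ = ⋃_n Σ_n`, and «by some other method, one has obtained an upper
bound for the volume of Σ̃», then that bound holds for the volume of `Σ` — for ANY measure («suitably defined volume»). The CONTAINMENT
bookkeeping (`Σ ⊆ Σ̃`, monotonicity); contrast (HllVl)'s SUBSET-from-below bookkeeping (E-cx `SubsetVolumeBound`). [folklore] -/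
theorem faq34_enlarge_then_bound {α : Type*} [MeasurableSpace α] (μ : Measure α) (Sn : ℕ → Set α) {B : ENNReal}
    (hB : μ (⋃ n, Sn n) ≤ B) : μ (Sn 1) ≤ B :=
  (measure_mono (Set.subset_iUnion Sn 1)).trans hB

/-- The same with an abstract enlarged set: `Σ ⊆ Σ̃` and `vol Σ̃ ≤ B` give `vol Σ ≤ B`. [folklore] -/
theorem enlarge_then_bound {α : Type*} [MeasurableSpace α] (μ : Measure α) {S S' : Set α} (h : S ⊆ S') {B : ENNReal}
    (hB : μ S' ≤ B) : μ S ≤ B :=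
  (measure_mono h).trans hB

end Summit.ABC.IUTFork.Joshi.Reports2025

end
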